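import Literature.NumberTheory.DiophantineApproximation.NesterenkoCriterionCore
import HarnessLib

/-!
# Nesterenko's linear independence criterion

Topic `Literature/NumberTheory/DiophantineApproximation`. Everything in this file is PROVED.

**Theorem** (Nesterenko 1985; in the form of Fischler, Sém. Bourbaki 910, Théorème 2.8). Let
`θ₁, …, θ_s` be real numbers and, for every `n`, `ℓ_n = p_{1,n} X₁ + ⋯ + p_{s,n} X_s` a linear form
with integer coefficients. Let `0 < α < 1 < β`. Assume `limsup |p_{j,n}|^{1/n} ≤ β` for every `j`
and `lim |ℓ_n(θ)|^{1/n} = α`. Then the `ℚ`-vector space spanned by `θ₁, …, θ_s` has dimension at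
least `1 − log α / log β` (`nesterenko_criterion`).

The `limsup` hypothesis is rendered as: for every `β' > β`, `|p_{j,n}| ≤ β'^n` for all large `n`.

Proof: reduce to a `ℚ`-basis `b` of the span containing `θ_{j₀} ≠ 0`, clear denominators of the
coordinates of the `θ_j`, rewrite the forms in the basis divided by `θ_{j₀}` (so one coordinate of
the point is `1`) and apply the quantitative core `NesterenkoCriterion.core`
(Chantanasiri 2012, Thm 1.1 / 2.1, the Fischler–Zudilin Minkowski argument) with
`Q_n = M β'^n`, `A_n = 1/Λ_n`, `B_n = a₂^{-1}(a₂/a₁)^n` for `a₁ < α < a₂`; letting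
`a₁, a₂ → α`, `β' → β` gives `−log α ≤ (d − 1) log β`.

## References

* Yu. V. Nesterenko, *On the linear independence of numbers*, Vestnik Moskov. Univ. Ser. I
  (1985) no. 1, 46–49; Moscow Univ. Math. Bull. 40 (1985) 69–74. [Nesterenko1985]
* S. Fischler, *Irrationalité de valeurs de zêta*, Sém. Bourbaki 910, Astérisque 294 (2004),
  Théorème 2.8. [Fischler2004]
* A. Chantanasiri, Ann. Math. Blaise Pascal 19 (2012) 75–105, Thm 1.1, Thm 2.1. [Chantanasiri2012]
-/

noncomputable section

open Filter Set Module
open scoped Topology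

namespace Literature.NumberTheory.DiophantineApproximation

namespace NesterenkoCriterion

/-! ### Elementary limit lemmas -/

/-- If `c uⁿ ≤ K vⁿ` for all large `n` (`c, u, v > 0`) then `u ≤ v`. [folklore] -/
theorem le_of_eventually_mul_pow_le {c K u v : ℝ} (hc : 0 < c) (hv : 0 < v)
    (h : ∀ᶠ n : ℕ in atTop, c * u ^ n ≤ K * v ^ n) : u ≤ v := by
  by_contra hlt
  push Not at hlt
  have hq : 1 < u / v := (one_lt_div hv).mpr hlt
  have ht := tendsto_pow_atTop_atTop_of_one_lt hq
  obtain ⟨n, hn1, hn2⟩ := (h.and (ht.eventually_gt_atTop (K / c))).exists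
  have hvn : 0 < v ^ n := pow_pos hv n
  have h1 : K < c * (u / v) ^ n := by rwa [div_lt_iff₀' hc] at hn2
  have h2 : c * u ^ n = c * (u / v) ^ n * v ^ n := by
    rw [div_pow, mul_assoc, div_mul_cancel₀ _ hvn.ne']
  have h3 : K * v ^ n < c * u ^ n := by rw [h2]; exact mul_lt_mul_of_pos_right h1 hvn
  linarith

/-- From `f(n)^{1/n} → α`: exponential upper and lower bounds `a₁ⁿ < f(n) < a₂ⁿ` for
`a₁ < α < a₂`, eventually. [folklore] -/
theorem eventually_pow_bounds {f : ℕ → ℝ} (hf : ∀ n, 0 ≤ f n) {α : ℝ}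
    (h : Tendsto (fun n : ℕ => f n ^ (1 / (n : ℝ))) atTop (𝓝 α)) :
    (∀ a, α < a → ∀ᶠ n in atTop, f n < a ^ n) ∧
      (∀ a, 0 ≤ a → a < α → ∀ᶠ n in atTop, a ^ n < f n) := by
  have key : ∀ n : ℕ, n ≠ 0 → (f n ^ (1 / (n : ℝ))) ^ n = f n := by
    intro n hn
    rw [one_div, Real.rpow_inv_natCast_pow (hf n) hn]
  constructor
  · intro a ha
    filter_upwards [h.eventually_lt_const ha, eventually_ne_atTop 0] with n hn hn0
    have h0 : 0 ≤ f n ^ (1 / (n : ℝ)) := Real.rpow_nonneg (hf n) _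
    calc f n = (f n ^ (1 / (n : ℝ))) ^ n := (key n hn0).symm
      _ < a ^ n := pow_lt_pow_left₀ hn h0 hn0
  · intro a ha0 ha
    filter_upwards [h.eventually_const_lt ha, eventually_ne_atTop 0] with n hn hn0
    calc a ^ n < (f n ^ (1 / (n : ℝ))) ^ n := pow_lt_pow_left₀ hn ha0 hn0
      _ = f n := key n hn0

/-! ### Clearing denominators -/

/-- A common denominator for finitely many rationals: `D = ∏ den`, and `q · D` is the integer
`num · (D / den)`. [folklore] -/
theorem exists_common_den {κ : Type*} [Fintype κ] (c : κ → ℚ) :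
    ∃ D : ℕ, 0 < D ∧ ∃ m : κ → ℤ, ∀ k, (m k : ℝ) = (c k : ℝ) * D := by
  classical
  refine ⟨∏ k, (c k).den, Finset.prod_pos fun k _ => (c k).den_pos, fun k =>
    (c k).num * ((∏ k, (c k).den) / (c k).den : ℕ), fun k => ?_⟩
  have hdvd : (c k).den ∣ ∏ k, (c k).den := Finset.dvd_prod_of_mem _ (Finset.mem_univ k)
  have hden : ((c k).den : ℝ) ≠ 0 := by exact_mod_cast (c k).den_pos.ne'
  have h1 : (((∏ k, (c k).den) / (c k).den : ℕ) : ℝ) = ((∏ k, (c k).den : ℕ) : ℝ) / (c k).den :=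
    Nat.cast_div hdvd hden
  have h2 : (c k : ℝ) = (c k).num / (c k).den := Rat.cast_def _
  simp only [Int.cast_mul, Int.cast_natCast]
  rw [h1, h2]
  field_simp

/-! ### The criterion -/

/-- **Nesterenko's linear independence criterion** (Nesterenko 1985; Fischler, Sém. Bourbaki 910,
Théorème 2.8). Let `θ : ι → ℝ` (finitely many reals) and integer linear forms
`ℓ_n = ∑_j p_{n,j} X_j`; let `0 < α < 1 < β` with `|p_{n,j}| ≤ β'^n` for all large `n`, for
every `β' > β` (i.e. `limsup |p_{n,j}|^{1/n} ≤ β`), and `|ℓ_n(θ)|^{1/n} → α`. Then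
`dim_ℚ (ℚθ₁ + ⋯ + ℚθ_s) ≥ 1 − log α / log β`.
[cite: Nesterenko1985, Theorem 1 (as stated in Fischler2004, Thm 2.8)] -/
theorem nesterenko_criterion {ι : Type*} [Fintype ι] (θ : ι → ℝ) (p : ℕ → ι → ℤ) {α β : ℝ}
    (hα : 0 < α) (hα1 : α < 1) (hβ : 1 < β)
    (hp : ∀ β' : ℝ, β < β' → ∀ᶠ n in atTop, ∀ j, |(p n j : ℝ)| ≤ β' ^ n)
    (hℓ : Tendsto (fun n : ℕ => |∑ j, (p n j : ℝ) * θ j| ^ (1 / (n : ℝ))) atTop (𝓝 α)) :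
    1 - Real.log α / Real.log β ≤ (finrank ℚ (Submodule.span ℚ (Set.range θ)) : ℝ) := by
  classical
  set ℓ : ℕ → ℝ := fun n => ∑ j, (p n j : ℝ) * θ j with hℓdef
  obtain ⟨hup, hlow⟩ := eventually_pow_bounds (fun n => abs_nonneg (ℓ n)) hℓ
  -- some `θ j₀ ≠ 0`
  obtain ⟨j₀, hj₀⟩ : ∃ j₀, θ j₀ ≠ 0 := by
    by_contra h0
    push Not at h0
    obtain ⟨n, hn⟩ := (hlow (α / 2) (by positivity) (by linarith)).exists
    have : ℓ n = 0 := by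
      simp only [hℓdef]; exact Finset.sum_eq_zero fun j _ => by rw [h0 j, mul_zero]
    rw [this, abs_zero] at hn
    exact absurd hn (not_lt.mpr (pow_nonneg (by positivity) n))
  -- the span, a basis through `θ j₀`
  set V : Submodule ℚ ℝ := Submodule.span ℚ (Set.range θ) with hV
  have hθV : ∀ j, θ j ∈ V := fun j => Submodule.subset_span ⟨j, rfl⟩
  haveI : Module.Finite ℚ V := Module.Finite.span_of_finite ℚ (Set.finite_range θ)
  set v₀ : V := ⟨θ j₀, hθV j₀⟩ with hv₀def
  have hv₀ : v₀ ≠ 0 := by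
    intro h
    apply hj₀
    have h' := congrArg Subtype.val h
    exact h'
  have hli : LinearIndepOn ℚ id ({v₀} : Set V) := LinearIndepOn.singleton hv₀
  set I : Set V := hli.extend (Set.subset_univ _) with hI
  let b : Basis I ℚ V := Basis.extend hli
  haveI : Fintype I := FiniteDimensional.fintypeBasisIndex b
  have hv₀I : v₀ ∈ I := Basis.subset_extend hli (Set.mem_singleton v₀)
  set i₀ : I := ⟨v₀, hv₀I⟩ with hi₀
  have hbi₀ : ((b i₀ : V) : ℝ) = θ j₀ := by
    rw [Basis.extend_apply_self]
  have hcard : Fintype.card I = finrank ℚ V := (finrank_eq_card_basis b).symm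
  -- coordinates of the `θ j` and a common denominator
  set c : ι × I → ℚ := fun ji => b.repr ⟨θ ji.1, hθV ji.1⟩ ji.2 with hc
  have hrepr : ∀ j, θ j = ∑ i, (c (j, i) : ℝ) * ((b i : V) : ℝ) := by
    intro j
    have h1 := b.sum_repr ⟨θ j, hθV j⟩
    have h2 := congrArg Subtype.val h1
    simp only [Submodule.coe_sum, Submodule.coe_smul, Rat.smul_def] at h2
    exact h2.symm
  obtain ⟨D, hD, m, hm⟩ := exists_common_den c
  have hDθ : ∀ j, (D : ℝ) * θ j = ∑ i, (m (j, i) : ℝ) * ((b i : V) : ℝ) := by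
    intro j
    rw [hrepr j, Finset.mul_sum]
    refine Finset.sum_congr rfl fun i _ => ?_
    rw [hm]; ring
  -- the new point `ξ` and forms `P`
  set ξ : I → ℝ := fun i => ((b i : V) : ℝ) / θ j₀ with hξdef
  have hξ : ξ i₀ = 1 := by simp only [hξdef]; rw [hbi₀, div_self hj₀]
  set P : ℕ → I → ℤ := fun n i => ∑ j, p n j * m (j, i) with hP
  set C : ℝ := D / θ j₀ with hC
  have hC0 : C ≠ 0 := div_ne_zero (by exact_mod_cast hD.ne') hj₀
  have hPξ : ∀ n, ∑ i, (P n i : ℝ) * ξ i = C * ℓ n := by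
    intro n
    simp only [hP, hξdef, hℓdef, hC]
    push_cast
    have e1 : ∀ i, (∑ j, (p n j : ℝ) * (m (j, i) : ℝ)) * (((b i : V) : ℝ) / θ j₀) =
        ∑ j, (p n j : ℝ) * ((m (j, i) : ℝ) * ((b i : V) : ℝ)) / θ j₀ := by
      intro i
      rw [Finset.sum_mul]
      refine Finset.sum_congr rfl fun j _ => ?_
      ring
    rw [Finset.sum_congr rfl (fun i _ => e1 i), Finset.sum_comm]
    simp_rw [← Finset.sum_div, ← Finset.mul_sum, ← hDθ]
    rw [Finset.mul_sum, Finset.sum_div]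
    refine Finset.sum_congr rfl fun j _ => ?_
    ring
  -- size of the new coefficients
  set M : ℝ := ∑ ji, |(m ji : ℝ)| + 1 with hM
  have hM0 : 0 < M := by
    have : 0 ≤ ∑ ji, |(m ji : ℝ)| := Finset.sum_nonneg fun _ _ => abs_nonneg _
    linarith
  have hPbound : ∀ n (β' : ℝ), 0 ≤ β' → (∀ j, |(p n j : ℝ)| ≤ β' ^ n) →
      ∑ i, |(P n i : ℝ)| ≤ M * β' ^ n := by
    intro n β' hβ' hpn
    simp only [hP]
    push_cast
    calc ∑ i, |∑ j, (p n j : ℝ) * (m (j, i) : ℝ)|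
        ≤ ∑ i, ∑ j, |(p n j : ℝ)| * |(m (j, i) : ℝ)| := by
          refine Finset.sum_le_sum fun i _ => (Finset.abs_sum_le_sum_abs _ _).trans ?_
          refine Finset.sum_le_sum fun j _ => ?_
          rw [abs_mul]
      _ ≤ ∑ i, ∑ j, β' ^ n * |(m (j, i) : ℝ)| := by
          refine Finset.sum_le_sum fun i _ => Finset.sum_le_sum fun j _ => ?_
          exact mul_le_mul_of_nonneg_right (hpn j) (abs_nonneg _)
      _ = β' ^ n * ∑ ji, |(m ji : ℝ)| := by
          rw [Fintype.sum_prod_type, Finset.mul_sum]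
          rw [Finset.sum_comm]
          refine Finset.sum_congr rfl fun j _ => ?_
          rw [Finset.mul_sum]
      _ ≤ M * β' ^ n := by
          rw [mul_comm]
          exact mul_le_mul_of_nonneg_right (by linarith) (pow_nonneg hβ' n)
  -- the key inequality, for every small `ε > 0`
  set r : ℕ := Fintype.card I - 1 with hr
  have hkey : ∀ ε : ℝ, 0 < ε → ε < -Real.log α →
      -Real.log α ≤ r * Real.log β + (3 * r + 1) * ε := by
    intro ε hε hεα
    set a₁ : ℝ := α * Real.exp (-ε) with ha₁
    set a₂ : ℝ := α * Real.exp ε with ha₂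
    set β' : ℝ := β * Real.exp ε with hβ'
    have hε1 : 1 < Real.exp ε := Real.one_lt_exp_iff.mpr hε
    have hε2 : Real.exp (-ε) < 1 := Real.exp_lt_one_iff.mpr (by linarith)
    have ha₁0 : 0 < a₁ := by positivity
    have ha₁α : a₁ < α := by
      have : α * Real.exp (-ε) < α * 1 := mul_lt_mul_of_pos_left hε2 hα
      simpa [ha₁] using this
    have hαa₂ : α < a₂ := by
      have : α * 1 < α * Real.exp ε := mul_lt_mul_of_pos_left hε1 hα
      simpa [ha₂] using this
    have ha₂0 : 0 < a₂ := hα.trans hαa₂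
    have ha₂1 : a₂ < 1 := by
      rw [ha₂]
      have : Real.exp ε < Real.exp (-Real.log α) := Real.exp_lt_exp.mpr hεα
      rw [Real.exp_neg, Real.exp_log hα] at this
      calc α * Real.exp ε < α * α⁻¹ := mul_lt_mul_of_pos_left this hα
        _ = 1 := mul_inv_cancel₀ hα.ne'
    have hββ' : β < β' := by
      have : β * 1 < β * Real.exp ε := mul_lt_mul_of_pos_left hε1 (by linarith)
      simpa [hβ'] using this
    have hβ'1 : 1 < β' := hβ.trans hββ'
    -- eventual bounds, and a threshold `N`
    obtain ⟨N, hN⟩ := eventually_atTop.mp ((hlow a₁ ha₁0.le ha₁α).and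
      ((hup a₂ hαa₂).and (hp β' hββ')))
    -- data for the core theorem
    set Q : ℕ → ℝ := fun n => M * β' ^ n with hQ
    set Λ' : ℕ → ℝ := fun n => |∑ i, (P n i : ℝ) * ξ i| with hΛ'
    have hΛ'eq : ∀ n, Λ' n = |C| * |ℓ n| := by
      intro n; simp only [hΛ']; rw [hPξ, abs_mul]
    set A : ℕ → ℝ := fun n => 1 / Λ' n with hA
    set B : ℕ → ℝ := fun n => a₂⁻¹ * (a₂ / a₁) ^ n with hB
    have hCpos : 0 < |C| := abs_pos.mpr hC0
    have hΛ'pos : ∀ n, N ≤ n → 0 < Λ' n := by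
      intro n hn
      rw [hΛ'eq]
      have := (hN n hn).1
      exact mul_pos hCpos ((pow_pos ha₁0 n).trans this)
    have hΛ'le : ∀ n, N ≤ n → Λ' n < |C| * a₂ ^ n := by
      intro n hn
      rw [hΛ'eq]
      exact mul_lt_mul_of_pos_left (hN n hn).2.1 hCpos
    -- apply the core with `n₀ = N + 1`
    have hcore := core (ι := I) i₀ ξ hξ P Q A B (N + 1)
      (fun n hn => hPbound n β' (by linarith) (hN n (by omega)).2.2)
      (fun n hn => hΛ'pos n (by omega))
      (fun n hn => by
        simp only [hA]; rw [one_div_one_div])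
      (fun n hn => by simp only [hA]; exact one_div_pos.mpr (hΛ'pos n (by omega)))
      (fun n hn => by
        -- `Λ'(n-1) ≤ B n Λ' n`
        change Λ' (n - 1) ≤ B n * Λ' n
        have h1 : Λ' (n - 1) < |C| * a₂ ^ (n - 1) := hΛ'le (n - 1) (by omega)
        have h2 : |C| * a₁ ^ n < Λ' n := by
          rw [hΛ'eq]; exact mul_lt_mul_of_pos_left (hN n (by omega)).1 hCpos
        have h3 : B n * (|C| * a₁ ^ n) = |C| * a₂ ^ (n - 1) := by
          simp only [hB]
          obtain ⟨k, rfl⟩ : ∃ k, n = k + 1 := ⟨n - 1, by omega⟩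
          rw [Nat.add_sub_cancel, div_pow, pow_succ a₂]
          field_simp
        have hB0 : 0 ≤ B n := by simp only [hB]; positivity
        nlinarith)
      (fun n hn => by
        simp only [hB, hQ]
        have h1 : a₂⁻¹ * (a₂ / a₁) ^ (n + 1) * (M * β' ^ (n + 1)) =
            a₂⁻¹ * (a₂ / a₁) ^ n * (M * β' ^ n) * (a₂ / a₁ * β') := by ring
        rw [h1]
        refine le_mul_of_one_le_right (by positivity) ?_
        have : 1 ≤ a₂ / a₁ := (one_le_div ha₁0).mpr (ha₁α.le.trans hαa₂.le)
        nlinarith)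
      (by
        -- `A n = 1 / Λ' n → ∞`
        have ht : Tendsto Λ' atTop (𝓝[>] 0) := by
          rw [tendsto_nhdsWithin_iff]
          refine ⟨?_, ?_⟩
          · have hg : Tendsto (fun n : ℕ => |C| * a₂ ^ n) atTop (𝓝 0) := by
              simpa using (tendsto_pow_atTop_nhds_zero_of_lt_one ha₂0.le ha₂1).const_mul |C|
            refine squeeze_zero' (Eventually.of_forall fun n => abs_nonneg _) ?_ hg
            filter_upwards [eventually_ge_atTop N] with n hn using (hΛ'le n hn).le
          · filter_upwards [eventually_ge_atTop N] with n hn using hΛ'pos n hn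
        have := ht.inv_tendsto_nhdsGT_zero
        refine this.congr fun n => ?_
        simp [hA])
    -- read off the exponential inequality
    have hev : ∀ᶠ n : ℕ in atTop, |C|⁻¹ * a₂⁻¹ ^ n ≤
        (4 * (2 * a₂⁻¹ * M) ^ r) * ((a₂ / a₁ * β') ^ r) ^ n := by
      filter_upwards [hcore, eventually_ge_atTop N] with n hn hnN
      have h1 : |C|⁻¹ * a₂⁻¹ ^ n < A n := by
        simp only [hA]
        rw [lt_one_div (by positivity) (hΛ'pos n hnN), one_div, mul_inv, inv_inv, ← inv_pow,
          inv_inv]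
        exact hΛ'le n hnN
      have h2 : (4 : ℝ) * (2 * B n * Q n) ^ (Fintype.card I - 1) =
          (4 * (2 * a₂⁻¹ * M) ^ r) * ((a₂ / a₁ * β') ^ r) ^ n := by
        rw [← hr]; simp only [hB, hQ]
        rw [← pow_mul, mul_comm r n, pow_mul]
        ring
      rw [← h2]
      exact (h1.trans hn).le
    have hle := le_of_eventually_mul_pow_le (inv_pos.mpr hCpos) (by positivity) hev
    -- take logarithms
    have hlog := Real.log_le_log (inv_pos.mpr ha₂0) hle
    have e1 : Real.log a₂⁻¹ = -(Real.log α + ε) := by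
      rw [Real.log_inv, ha₂, Real.log_mul hα.ne' (Real.exp_pos ε).ne', Real.log_exp]
    have e2 : Real.log ((a₂ / a₁ * β') ^ r) = r * (3 * ε + Real.log β) := by
      rw [Real.log_pow, Real.log_mul (div_pos ha₂0 ha₁0).ne' (zero_lt_one.trans hβ'1).ne',
        Real.log_div ha₂0.ne' ha₁0.ne', ha₂, ha₁, hβ', Real.log_mul hα.ne' (Real.exp_pos _).ne',
        Real.log_mul hα.ne' (Real.exp_pos _).ne', Real.log_mul (by linarith) (Real.exp_pos _).ne',
        Real.log_exp, Real.log_exp]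
      ring
    rw [e1, e2] at hlog
    nlinarith [hlog]
  -- conclude: `-log α ≤ r log β`
  have hlogβ : 0 < Real.log β := Real.log_pos hβ
  have hlogα : 0 < -Real.log α := by
    have := Real.log_neg hα hα1; linarith
  have hmain : -Real.log α ≤ r * Real.log β := by
    by_contra hlt
    push Not at hlt
    set g : ℝ := -Real.log α - r * Real.log β with hg
    have hgpos : 0 < g := by linarith
    set ε : ℝ := min (-Real.log α / 2) (g / (2 * (3 * r + 1))) with hεdef
    have hr0 : (0 : ℝ) < 3 * r + 1 := by positivity
    have hε : 0 < ε := lt_min (by linarith) (by positivity)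
    have hε1 : ε < -Real.log α := (min_le_left _ _).trans_lt (by linarith)
    have hε2 : (3 * r + 1) * ε ≤ g / 2 := by
      have : ε ≤ g / (2 * (3 * r + 1)) := min_le_right _ _
      rw [le_div_iff₀ (by positivity)] at this
      linarith
    have := hkey ε hε hε1
    linarith
  -- `finrank = r + 1`
  have hcardpos : 0 < Fintype.card I := Fintype.card_pos_iff.mpr ⟨i₀⟩
  have hfr : (finrank ℚ V : ℝ) = r + 1 := by
    rw [← hcard, hr]
    norm_cast
    omega
  rw [hfr, sub_le_iff_le_add]
  have : -Real.log α / Real.log β ≤ r := by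
    rw [div_le_iff₀ hlogβ]; exact hmain
  have h2 : Real.log α / Real.log β = -(-Real.log α / Real.log β) := by ring
  linarith

end NesterenkoCriterion

end Literature.NumberTheory.DiophantineApproximation
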